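import Literature.Analysis.Pluripotential.MongeAmpereComparisonMass
import Literature.Analysis.Pluripotential.RegularMassExhaustion
import Literature.Analysis.Pluripotential.RegularMassChartChange
import Literature.Analysis.Pluripotential.ChartPotentialRegularisation
import Literature.Analysis.Pluripotential.NonPluripolarMongeAmpereMassSiuProofs
import HarnessLib

/-!
# Proof of `GuedjZeriahi2007_lelongNumber_eq_zero_of_regularMass_eq`

Topic `Literature/Analysis/Pluripotential`. The discharge
`GuedjZeriahi2007_lelongNumber_eq_zero_of_regularMass_eq_holds` of the named fact of
`NonPluripolarMongeAmpereMass.lean` (honest-object form of Guedj–Zeriahi 2007, Cor. 1.8: a closed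
positive `(1,1)`-current on `ℙᴺ` of degree `c > 0` whose regular part already carries the full
Monge–Ampère mass `cᴺ` has zero Lelong numbers everywhere).

## The argument (following the proof of Cor. 1.8, in the affine chart and with smooth data)

Suppose `ν(T, x) > 0`. After a transposition of homogeneous coordinates
(`ClosedPositiveOneOneCurrent.exists_swap`, `RegularMassChartChange.lean` — it does not change the
degree, the regular mass, or the Lelong numbers) the point `x` lies in the chart `{z₀ ≠ 0}`,
`x = [1 : w₀]`, and a positive Lelong number gives a logarithmic pole
`V(1, w) ≤ γ log ‖w - w₀‖ + C` near `w₀` (`exists_pos_mem_lelongSlopes`,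
`eventually_pot_chartVec_le_log`). Fix a compact `K ⊆ Reg(T)`. Regularise the chart potential by
convolution (`ChartPotentialRegularisation.lean`, built on the mollifier files of the tree): the
smooth psh approximants `g_n` stay below `c · fsPotential + M`, inherit the pole bound on small balls
around `w₀`, stay above `inf g` near `K`, and `MA(g_n) → MA(g)` pointwise on `Reg(T)`. The smooth
comparison principle with the glued comparison function of `MongeAmpereComparison(Mass).lean`
(`setLIntegral_heightDensity_add_le_of_logPole`: Stokes for compactly supported perturbations,
`MongeAmpereStokes.lean`, and the explicit bump masses, `MongeAmpereAffine.lean`) gives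
`∫_K MA(g_n) + tᴺ μ_FS(B(0,1)) ≤ ((1+δ)c)ᴺ` with `t = min(γ/2, c)`; Fatou (`n → ∞`) and `δ → 0` give
`∫_K MA(g) + tᴺ μ_FS(B(0,1)) ≤ cᴺ`, and inner regularity (`RegularMassExhaustion.lean`) gives
`regularMass N T ≤ cᴺ - tᴺ μ_FS(B(0,1)) < cᴺ`, contradicting the hypothesis. (`N = 0` is the trivial
`lelongNumber_eq_zero_of_dim_zero`.)

## References

* [GuedjZeriahi2007] V. Guedj, A. Zeriahi, The weighted Monge–Ampère energy of quasiplurisubharmonic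
  functions, J. Funct. Anal. 250 (2007) 442–482: Cor. 1.8 and its proof (p. 451), Thm. 1.5,
  Prop. 1.6.
-/

noncomputable section

open scoped Topology ENNReal ComplexOrder
open MeasureTheory Filter Set Metric Complex
open Literature.AlgebraicGeometry.HodgeTheory.BiextensionHeight (leviMatrix heightDensity
  fsPotential chartVec)

namespace Literature.Analysis.Pluripotential

/-! ## (P8) Assembly -/

namespace ClosedPositiveOneOneCurrent

variable {N : ℕ} (T : ClosedPositiveOneOneCurrent N)

/-- **The mass defect on a compact subset of the regular locus** caused by a logarithmic pole of the
cone potential at a chart point, given a regularising family `G ε₀ n` of the chart potential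
(smooth, Levi `≥ 0`, controlled growth, local upper/lower control at scale `ε₀`, convergence of the
Monge–Ampère densities on the regular locus). [cite: GuedjZeriahi2007, Cor. 1.8 (proof)] -/
theorem setLIntegral_add_le_of_pole (hc : 0 < T.degree) {w₀ : Fin N → ℂ} {γ C ρp t : ℝ}
    (ht : 0 < t) (htc : t ≤ T.degree) (htγ : t < γ) (hρp : 0 < ρp)
    (hpole : ∀ w : Fin N → ℂ, 0 < dist w w₀ → dist w w₀ < ρp →
      T.pot (chartVec w) ≤ ((γ * Real.log (dist w w₀) + C : ℝ) : EReal))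
    (hbot : T.pot (chartVec w₀) = ⊥) {M : ℝ} (G : ∀ ε₀ : ℝ, 0 < ε₀ → ℕ → (Fin N → ℂ) → ℝ)
    (hG : ∀ (ε₀ : ℝ) (hε₀ : 0 < ε₀), ε₀ ≤ 1 →
      (∀ n, ContDiff ℝ 3 (G ε₀ hε₀ n)) ∧
      (∀ n w v, 0 ≤ fderiv ℝ (fderiv ℝ (G ε₀ hε₀ n)) w v v
        + fderiv ℝ (fderiv ℝ (G ε₀ hε₀ n)) w (I • v) (I • v)) ∧
      (∀ n w, G ε₀ hε₀ n w ≤ T.degree * fsPotential w + M) ∧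
      (∀ n (w : Fin N → ℂ) (m : ℝ), (∀ y ∈ closedBall w ε₀, T.pot (chartVec y) ≤ (m : EReal)) →
        G ε₀ hε₀ n w ≤ m) ∧
      (∀ n (w : Fin N → ℂ) (m : ℝ), (∀ y ∈ closedBall w ε₀, m ≤ T.chartPotential y) →
        m ≤ G ε₀ hε₀ n w) ∧
      (∀ w ∈ T.regularLocus, Tendsto (fun n ↦ heightDensity N (G ε₀ hε₀ n) w) atTop
        (𝓝 (heightDensity N T.chartPotential w))))
    {K : Set (Fin N → ℂ)} (hK : IsCompact K) (hKreg : K ⊆ T.regularLocus) :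
    (∫⁻ w in K, ENNReal.ofReal (heightDensity N T.chartPotential w))
      + ENNReal.ofReal (t ^ N) * ∫⁻ w in ball (0 : Fin N → ℂ) 1,
          ENNReal.ofReal (heightDensity N fsPotential w)
      ≤ ENNReal.ofReal (T.degree ^ N) := by
  set c := T.degree with hcdef
  set g := T.chartPotential with hgdef
  set μ₁ : ℝ≥0∞ := ∫⁻ w in ball (0 : Fin N → ℂ) 1, ENNReal.ofReal (heightDensity N fsPotential w)
    with hμ₁
  have hγ0 : 0 ≤ γ := by linarith
  -- `K` is bounded
  obtain ⟨RK', hRK'⟩ := hK.isBounded.subset_closedBall (0 : Fin N → ℂ)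
  set RK := max RK' 0 with hRK
  have hKbdd : ∀ w ∈ K, ‖w‖ ≤ RK := fun w hw ↦ by
    have := hRK' hw
    rw [mem_closedBall, dist_zero_right] at this
    exact this.trans (le_max_left _ _)
  -- a compact neighbourhood of `K` inside the regular locus, and a lower bound of `g` there
  obtain ⟨ηK, hηK, hthick⟩ := hK.exists_cthickening_subset_open T.isOpen_regularLocus hKreg
  have hgcont : ContinuousOn g (cthickening ηK K) := fun w hw ↦
    (show ContDiffAt ℝ 2 g w from hthick hw).continuousAt.continuousWithinAt
  obtain ⟨mK', hmK'⟩ : ∃ m : ℝ, ∀ w ∈ cthickening ηK K, m ≤ g w := by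
    rcases (cthickening ηK K).eq_empty_or_nonempty with hKe | hKne
    · exact ⟨0, by simp [hKe]⟩
    · obtain ⟨w₁, -, hmin⟩ := hK.cthickening.exists_isMinOn hKne hgcont
      exact ⟨g w₁, fun w hw ↦ hmin hw⟩
  set mK := mK' - 1 with hmK
  -- the bound for every `δ > 0`
  have main : ∀ δ : ℝ, 0 < δ → (∫⁻ w in K, ENNReal.ofReal (heightDensity N g w))
      + ENNReal.ofReal (t ^ N) * μ₁ ≤ ENNReal.ofReal (((1 + δ) * c) ^ N) := by
    intro δ hδ
    set cF := (1 + δ) * c with hcF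
    set Λ₁ := Real.log (1 + N * (‖w₀‖ + 1) ^ 2) / 2 with hΛ₁
    set ΛK := Real.log (1 + N * RK ^ 2) / 2 with hΛK
    set ΛK' := Real.log (1 + N * (RK + ‖w₀‖) ^ 2) / 2 with hΛK'
    set K₀ := max (t * ΛK' + cF * Λ₁ + 1 + t * Real.log 2) (cF * ΛK) + 3 - mK with hK₀
    set C₃ := cF * Λ₁ - K₀ + 1 + t * Real.log 2 with hC₃
    set Cp := γ * Real.log 2 + C + 1 with hCp
    set η := min (min (1 / 2 : ℝ) ηK) (min (ρp / 4) (Real.exp ((C₃ - Cp - 2) / (γ - t))))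
      with hηdef
    have hη : 0 < η := by positivity
    have hη1 : η ≤ 1 := ((min_le_left _ _).trans (min_le_left _ _)).trans (by norm_num)
    have hηK' : η ≤ ηK := (min_le_left _ _).trans (min_le_right _ _)
    have hηρ : η ≤ ρp / 4 := (min_le_right _ _).trans (min_le_left _ _)
    have hηexp : η ≤ Real.exp ((C₃ - Cp - 2) / (γ - t)) := (min_le_right _ _).trans (min_le_right _ _)
    have hsmall : γ * Real.log (1 * η) + Cp + 1 < t * Real.log η + C₃ := by
      rw [one_mul]
      have hγt' : 0 < γ - t := by linarith
      have hlog : Real.log η ≤ (C₃ - Cp - 2) / (γ - t) := by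
        rw [Real.log_le_iff_le_exp hη]; exact hηexp
      rw [le_div_iff₀ hγt'] at hlog
      nlinarith
    have hK₀₁ : t * ΛK' + cF * Λ₁ + 1 + t * Real.log 2 ≤ K₀ + mK - 3 := by
      have := le_max_left (t * ΛK' + cF * Λ₁ + 1 + t * Real.log 2) (cF * ΛK)
      rw [hK₀]; linarith
    have hK₀₂ : cF * ΛK ≤ K₀ + mK - 3 := by
      have := le_max_right (t * ΛK' + cF * Λ₁ + 1 + t * Real.log 2) (cF * ΛK)
      rw [hK₀]; linarith
    -- the regularising sequence at scale `η`
    obtain ⟨hG3, hLG, hGq, hGup, hGlow, hGlim⟩ := hG η hη hη1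
    -- the bound for every member of the sequence
    have step : ∀ n : ℕ, (∫⁻ w in K, ENNReal.ofReal (heightDensity N (G η hη n) w))
        + ENNReal.ofReal (t ^ N) * μ₁ ≤ ENNReal.ofReal (cF ^ N) := by
      intro n
      -- the pole bound
      have hpole' : ∀ w ∈ ball w₀ (1 * η), G η hη n w ≤ γ * Real.log (1 * η) + Cp := by
        intro w hw
        rw [one_mul] at hw ⊢
        have hm : ∀ y ∈ closedBall w η,
            T.pot (chartVec y) ≤ ((γ * Real.log (2 * η) + C : ℝ) : EReal) := by
          intro y hy
          by_cases hy0 : y = w₀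
          · rw [hy0, hbot]; exact bot_le
          · have hd0 : 0 < dist y w₀ := dist_pos.2 hy0
            rw [mem_closedBall] at hy
            rw [mem_ball] at hw
            have hd : dist y w₀ ≤ 2 * η := (dist_triangle y w w₀).trans (by linarith)
            have hdρ : dist y w₀ < ρp := by linarith
            refine (hpole y hd0 hdρ).trans ?_
            have hl : Real.log (dist y w₀) ≤ Real.log (2 * η) := Real.log_le_log hd0 hd
            exact_mod_cast (show γ * Real.log (dist y w₀) + C ≤ γ * Real.log (2 * η) + C by
              nlinarith)
        have h := hGup n w _ hm
        have hl2 : Real.log (2 * η) = Real.log 2 + Real.log η := Real.log_mul two_ne_zero hη.ne'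
        rw [hl2] at h
        rw [hCp]
        nlinarith
      -- the lower bound on `K`
      have hKg' : ∀ w ∈ K, mK ≤ G η hη n w := fun w hw ↦ by
        have h1 : mK' ≤ G η hη n w := hGlow n w mK' fun y hy ↦ hmK' y (by
          rw [mem_closedBall] at hy
          exact mem_cthickening_of_dist_le y w ηK K hw (hy.trans hηK'))
        rw [hmK]; linarith
      exact setLIntegral_heightDensity_add_le_of_logPole (N := N) (R := 1) hc ht htc hδ (hG3 n)
        (hLG n) (hGq n) hK.measurableSet hKbdd hKg' hη hη1 (by linarith) hpole' hK₀₁ hK₀₂ hsmall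
    -- Fatou along the sequence
    have hmtop : ENNReal.ofReal (t ^ N) * μ₁ ≠ ⊤ := by
      refine ENNReal.mul_ne_top ENNReal.ofReal_ne_top (ne_top_of_le_ne_top ENNReal.one_ne_top ?_)
      rw [← lintegral_heightDensity_fsPotential (N := N)]
      exact setLIntegral_le_lintegral _ _
    have hmle : ENNReal.ofReal (t ^ N) * μ₁ ≤ ENNReal.ofReal (cF ^ N) :=
      le_trans (by simp) (step 0)
    have hstep' : ∀ n : ℕ, ∫⁻ w in K, ENNReal.ofReal (heightDensity N (G η hη n) w)
        ≤ ENNReal.ofReal (cF ^ N) - ENNReal.ofReal (t ^ N) * μ₁ := fun n ↦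
      ENNReal.le_sub_of_add_le_right hmtop (step n)
    have hfatou : ∫⁻ w in K, ENNReal.ofReal (heightDensity N g w)
        ≤ ENNReal.ofReal (cF ^ N) - ENNReal.ofReal (t ^ N) * μ₁ := by
      have hlim : ∀ w ∈ K, liminf (fun n ↦ ENNReal.ofReal (heightDensity N (G η hη n) w)) atTop
          = ENNReal.ofReal (heightDensity N g w) := fun w hw ↦
        ((ENNReal.continuous_ofReal.tendsto _).comp (hGlim w (hKreg hw))).liminf_eq
      calc ∫⁻ w in K, ENNReal.ofReal (heightDensity N g w)
          = ∫⁻ w in K, liminf (fun n ↦ ENNReal.ofReal (heightDensity N (G η hη n) w)) atTop :=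
            setLIntegral_congr_fun hK.measurableSet fun w hw ↦ (hlim w hw).symm
        _ ≤ liminf (fun n ↦ ∫⁻ w in K, ENNReal.ofReal (heightDensity N (G η hη n) w)) atTop :=
            lintegral_liminf_le fun n ↦ measurable_ofReal_heightDensity_self _
        _ ≤ ENNReal.ofReal (cF ^ N) - ENNReal.ofReal (t ^ N) * μ₁ :=
            liminf_le_of_frequently_le' (Eventually.of_forall hstep').frequently
    calc (∫⁻ w in K, ENNReal.ofReal (heightDensity N g w)) + ENNReal.ofReal (t ^ N) * μ₁
        ≤ (ENNReal.ofReal (cF ^ N) - ENNReal.ofReal (t ^ N) * μ₁) + ENNReal.ofReal (t ^ N) * μ₁ :=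
          add_le_add hfatou le_rfl
      _ = ENNReal.ofReal (cF ^ N) := tsub_add_cancel_of_le hmle
  -- let `δ → 0`
  have hlim : Tendsto (fun δ : ℝ ↦ ENNReal.ofReal (((1 + δ) * c) ^ N)) (𝓝[>] 0)
      (𝓝 (ENNReal.ofReal (c ^ N))) := by
    have hcont : Continuous fun δ : ℝ ↦ ENNReal.ofReal (((1 + δ) * c) ^ N) :=
      ENNReal.continuous_ofReal.comp (by fun_prop)
    have := hcont.tendsto 0
    simp only [add_zero, one_mul] at this
    exact this.mono_left nhdsWithin_le_nhds
  exact ge_of_tendsto hlim (eventually_nhdsWithin_of_forall fun δ hδ ↦ main δ hδ)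

/-- **Chart case: a positive Lelong number of the cone potential at a chart point `(1, w₀)` forces
`regularMass N T < (deg T)ᴺ`** (given the regularisation). [cite: GuedjZeriahi2007, Cor. 1.8] -/
theorem regularMass_lt_of_lelongNumber_chartVec_pos (hc : 0 < T.degree) {w₀ : Fin N → ℂ}
    (hν : 0 < Pluripotential.lelongNumber T.pot (chartVec w₀)) :
    T.regularMass N < ENNReal.ofReal (T.degree ^ N) := by
  obtain ⟨γ, hγ0, hγ⟩ := exists_pos_mem_lelongSlopes hν.ne'
  obtain ⟨C, hC⟩ := T.eventually_pot_chartVec_le_log hγ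
  obtain ⟨ρp, hρp, hballρ⟩ := Metric.mem_nhdsWithin_iff.1 hC
  have hpole : ∀ w : Fin N → ℂ, 0 < dist w w₀ → dist w w₀ < ρp →
      T.pot (chartVec w) ≤ ((γ * Real.log (dist w w₀) + C : ℝ) : EReal) := by
    intro w h1 h2
    have hw : w ∈ ball w₀ ρp ∩ {w₀}ᶜ := ⟨mem_ball.2 h2, dist_pos.1 h1⟩
    have := hballρ hw
    simpa [dist_eq_norm] using this
  have hbot : T.pot (chartVec w₀) = ⊥ := T.pot_eq_bot_of_lelongNumber_pos (chartVec_ne_zero w₀) hν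
  set t := min (γ / 2) T.degree with htdef
  have ht : 0 < t := lt_min (by linarith) hc
  have htc : t ≤ T.degree := min_le_right _ _
  have htγ : t < γ := (min_le_left _ _).trans_lt (by linarith)
  obtain ⟨M, hM⟩ := T.exists_regularisation
  set μ₁ : ℝ≥0∞ := ∫⁻ w in ball (0 : Fin N → ℂ) 1, ENNReal.ofReal (heightDensity N fsPotential w)
    with hμ₁
  set m : ℝ≥0∞ := ENNReal.ofReal (t ^ N) * μ₁ with hm
  have hm0 : m ≠ 0 := by
    refine (ENNReal.mul_pos (ENNReal.ofReal_pos.2 (by positivity)).ne' ?_).ne'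
    exact (setLIntegral_heightDensity_fsPotential_ball_pos one_pos).ne'
  have hmtop : m ≠ ⊤ := by
    refine ENNReal.mul_ne_top ENNReal.ofReal_ne_top (ne_top_of_le_ne_top ENNReal.one_ne_top ?_)
    rw [← lintegral_heightDensity_fsPotential (N := N)]
    exact setLIntegral_le_lintegral _ _
  have hbound : T.regularMass N ≤ ENNReal.ofReal (T.degree ^ N) - m := by
    refine T.regularMass_le_of_forall_isCompact _ fun K hK hKreg ↦ ?_
    exact ENNReal.le_sub_of_add_le_right hmtop
      (T.setLIntegral_add_le_of_pole hc ht htc htγ hρp hpole hbot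
        (fun ε₀ hε₀ n ↦ T.mollifiedChartPotential ε₀ hε₀ n) hM hK hKreg)
  refine hbound.trans_lt (ENNReal.sub_lt_self ENNReal.ofReal_ne_top ?_ hm0)
  exact (ENNReal.ofReal_pos.2 (by positivity)).ne'

end ClosedPositiveOneOneCurrent

/-- **Discharge of `GuedjZeriahi2007_lelongNumber_eq_zero_of_regularMass_eq`.**
[cite: GuedjZeriahi2007, Cor. 1.8] -/
theorem GuedjZeriahi2007_lelongNumber_eq_zero_of_regularMass_eq_holds :
    GuedjZeriahi2007_lelongNumber_eq_zero_of_regularMass_eq := by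
  intro N
  cases N with
  | zero =>
    intro T _ _ x
    exact ClosedPositiveOneOneCurrent.lelongNumber_eq_zero_of_dim_zero T x
  | succ n =>
    intro T hc hmass x
    by_contra hx
    have hxpos : 0 < T.lelongNumber x := lt_of_le_of_ne (T.lelongNumber_nonneg x) (Ne.symm hx)
    set v := x.rep with hv
    have hv0 : v ≠ 0 := x.rep_nonzero
    obtain ⟨i, hi⟩ : ∃ i, v i ≠ 0 := Function.ne_iff.1 hv0
    obtain ⟨T', hdeg, hreg, hlel⟩ := T.exists_swap i
    set v' : Fin (n + 2) → ℂ := fun j ↦ v (Equiv.swap 0 i j) with hv'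
    have hv'0 : v' 0 ≠ 0 := by
      simp only [hv', Equiv.swap_apply_left]; exact hi
    set w₀ : Fin (n + 1) → ℂ := fun j ↦ v' j.succ / v' 0 with hw₀
    have hsmul : v' = v' 0 • chartVec w₀ := eq_smul_chartVec hv'0
    have hν : 0 < Pluripotential.lelongNumber T'.pot (chartVec w₀) := by
      have h1 : Pluripotential.lelongNumber T'.pot v'
          = Pluripotential.lelongNumber T'.pot (chartVec w₀) := by
        conv_lhs => rw [hsmul]
        exact T'.isLogHomogeneous_pot.lelongNumber_smul hv'0 (chartVec_ne_zero w₀)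
      rw [← h1, hlel v hv0]
      exact hxpos
    have hlt := T'.regularMass_lt_of_lelongNumber_chartVec_pos (hdeg ▸ hc) hν
    rw [hreg, hdeg, hmass] at hlt
    exact lt_irrefl _ hlt


end Literature.Analysis.Pluripotential

end
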